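import Summits.QuantumFields.YangMills.Theorems.AlphaInputsT3ACv3StartRows
import Summits.QuantumFields.YangMills.Theorems.AlphaInputsT3ACv3StartT3
import HarnessLib

/-!
# `AlphaInputsT3ACv3StartRowsLine` — START v3.1 for the (FL) `hLift` binder, row (S5)-4: **THE REMAINING NUMERAL ROWS** (complementing ★w5 g2's `…StartRows`): from `16 ≤ L^k` the
# lattice-size rows of `…StartLine` (`R < ⌊L^k∕2⌋`, `Rt + 2 ≤ L^k`) and of the chart (`2·max(Rt, ⌊L^k∕2⌋) + 1 ≤ N₀`, `2R + 1 ≤ N₀` from `L^k ≤ N₀`); the START's flatness numeral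
# `max(b, 81601·b) ≤ 83559424·ε′∕(L^k)²`; and the tubes' LOG WINDOW `hF` from `dist1 V(∂Q) ≤ ε′ ≤ 1∕4`, `|n|·ε′ < π` — lane `pub-balaban3d` ∕ cell `ym3-torus`, seat `ym-ust-19936-w1`
# (g2, LEAD)

WHY (bus PROGRESS 6 (iii)–(iv)).  ★w5 g2's `…StartRows` (`startRows`, `tubeBound_le`, `two_mul_RbT_add_one_le`, `eta0_le_of_boxBound`) covers the shell rows of `…StartT3`; THIS FILE
adds the rows consumed by `…StartLine` (`centre_not_isBallΩ`: `RbT < ⌊L^k∕2⌋`; `centre_not_tubeActive`: `RtT + 2 ≤ L^k`, the chart row, the log window `hF`) and the closed flatness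
numeral of the START.  Arithmetic only.
WHAT IS HERE: `RbT_lt_half`, `RtT_add_two_le`, `max_RtT_half_eq`, `hN_of_pow_le`, `hNb_of_pow_le`, `startBound_le`, ★`hF_of_dist1`.
HONEST FRAMING.  Arithmetic; (FL)∕`hLift` NOT proved; count-neutral helper toward R3 2′ (items 19936∕19935); registry untouched; nothing about d = 4, the continuum, or a mass gap;
YM₃ on T³ is rung R3, not Clay.

References: T. Bałaban, Commun. Math. Phys. 102 (1985) 277–309 [Balaban1985Variational] ((14)–(15) p.280).
-/

set_option autoImplicit false

noncomputable section

open scoped Matrix.Norms.L2Operator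

namespace Summit.QuantumFields.YangMills.Theorems.TubeStart

open Literature.MathematicalPhysics.QuantumFieldTheory.Balaban1983to89
open Literature.MathematicalPhysics.QuantumFieldTheory.Balaban1983to89.T4AdjointCovarianceUnitary (lieSU expSU)
open Literature.MathematicalPhysics.QuantumFieldTheory.Balaban1983to89.B10Eq38TorusDomains (toFine plaqsIn)
open Summit.QuantumFields.YangMills.Theorems.ModelBox
open Summit.QuantumFields.YangMills.Theorems.PerturbedPlaquette (dist1_SU_eq)

/-! ## §1 Lattice-size rows from `16 ≤ L^k` -/

section NatRows

variable (P : Params) (k : ℕ) (hm : 16 ≤ P.L ^ k)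
include hm

/-- `R < ⌊L^k∕2⌋` (the vertex cubes miss the centre lines). [folklore] -/
theorem RbT_lt_half : RbT P k < P.L ^ k / 2 := by unfold RbT rT; omega

/-- `Rt + 2 ≤ L^k` (the tube chart row of `…TubeGraft`). [folklore] -/
theorem RtT_add_two_le : RtT P k + 2 ≤ P.L ^ k := by unfold RtT rT; omega

/-- `max(Rt, ⌊L^k∕2⌋) = ⌊L^k∕2⌋`. [folklore] -/
theorem max_RtT_half_eq : max (RtT P k) (P.L ^ k / 2) = P.L ^ k / 2 := by
  apply max_eq_right; unfold RtT rT; omega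

/-- The chart row `2·max(Rt, ⌊L^k∕2⌋) + 1 ≤ N₀` from `L^k ≤ N₀` (`L^k` is odd). [folklore] -/
theorem hN_of_pow_le (hN : P.L ^ k ≤ P.sitesPerDir 0) : 2 * max (RtT P k) (P.L ^ k / 2) + 1 ≤ P.sitesPerDir 0 := by
  rw [max_RtT_half_eq P k hm]
  have := pow_eq_two_mul_half_add_one (P := P) k
  omega

/-- `2R + 1 ≤ N₀` from `L^k ≤ N₀`. [folklore] -/
theorem hNb_of_pow_le (hN : P.L ^ k ≤ P.sitesPerDir 0) : 2 * RbT P k + 1 ≤ P.sitesPerDir 0 := (two_mul_RbT_add_one_le P k hm).trans hN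

end NatRows

/-! ## §2 The START's flatness numeral -/

section RealRows

variable (P : Params) (k : ℕ) (hm : 16 ≤ P.L ^ k)
include hm

/-- **THE START's FLATNESS NUMERAL**: with `b := exp((2r+1)⁻²·2ε′) − 1`, `max(b, 81601·b) ≤ 83559424·ε′∕(L^k)²` (`0 ≤ ε′ ≤ 1∕4`, `16 ≤ L^k`). [cite: Balaban1985Variational, (14) p.280] -/
theorem startBound_le {ε' : ℝ} (hε : 0 ≤ ε') (hε4 : ε' ≤ 1 / 4) :
    max (Real.exp (((2 * (rT P k : ℝ) + 1))⁻¹ ^ 2 * (2 * ε')) - 1) (81601 * (Real.exp (((2 * (rT P k : ℝ) + 1))⁻¹ ^ 2 * (2 * ε')) - 1)) ≤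
      83559424 * ε' / ((P.L ^ k : ℕ) : ℝ) ^ 2 := by
  have hb := tubeBound_le P k hε hε4
  have hb0 := tubeBound_nonneg P k hε
  have hpos : (0 : ℝ) ≤ ε' / ((P.L ^ k : ℕ) : ℝ) ^ 2 := by positivity
  apply max_le
  · calc _ ≤ 1024 * ε' / ((P.L ^ k : ℕ) : ℝ) ^ 2 := hb
      _ = 1024 * (ε' / ((P.L ^ k : ℕ) : ℝ) ^ 2) := by ring
      _ ≤ 83559424 * (ε' / ((P.L ^ k : ℕ) : ℝ) ^ 2) := by nlinarith
      _ = 83559424 * ε' / ((P.L ^ k : ℕ) : ℝ) ^ 2 := by ring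
  · calc _ ≤ 81601 * (1024 * ε' / ((P.L ^ k : ℕ) : ℝ) ^ 2) := by linarith
      _ = 83559424 * ε' / ((P.L ^ k : ℕ) : ℝ) ^ 2 := by ring

end RealRows

/-! ## §3 The tubes' log window -/

section Window

variable {P : Params} {n : Type*} [Fintype n] [DecidableEq n] [Nonempty n] (k : ℕ) (Ω : Set (Site P 0)) (V : GaugeField P k (Matrix.specialUnitaryGroup n ℂ))

/-- **★ THE `hF` BINDER** of `…TubeGraft`∕`…StartLine` for every tube of the system, from `dist1 V(∂Q) ≤ ε′ ≤ 1∕4` on `plaqsIn k Ω` and `|n|·ε′ < π`. [cite: Balaban1985Variational, (15) p.280] -/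
theorem hF_of_dist1 {ε' : ℝ} (hV : ∀ Q, Q ∈ plaqsIn k Ω → GaugeGroup.dist1 (GaugeField.plaqHol V Q) ≤ ε') (hε4 : ε' ≤ 1 / 4) (hnπ : (Fintype.card n : ℝ) * ε' < Real.pi) :
    ∀ Q, IsTubeΩ k Ω Q → expSU (FpOf k V Q) = V ⟨Q.src, Q.ν⟩ * V ⟨Q.src.shift Q.ν, Q.μ⟩ * (V ⟨Q.src.shift Q.μ, Q.ν⟩)⁻¹ * (V ⟨Q.src, Q.μ⟩)⁻¹ := by
  intro Q hQ
  have hd : ‖((wordQ k V Q : Matrix.specialUnitaryGroup n ℂ) : Matrix n n ℂ) - 1‖ ≤ ε' := by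
    rw [← dist1_SU_eq, wordQ_eq_inv, GaugeGroup.dist1_inv]; exact hV Q hQ
  refine expSU_FpOf k V Q ⟨hd.trans hε4, lt_of_le_of_lt ?_ hnπ⟩
  exact mul_le_mul_of_nonneg_left hd (Nat.cast_nonneg _)

end Window

end Summit.QuantumFields.YangMills.Theorems.TubeStart

end
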